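import Literature.Analysis.FluidPDE.ElgindiHkClosure
import HarnessLib

/-!
# The `𝓦^{l,∞}` norm of Elgindi–Ghoul–Masmoudi
([ElgindiGhoulMasmoudi2021] §1.7: the weighted sup norm of the coefficients)

Topic `Literature/Analysis/FluidPDE`. Support file (definitions with bodies and proved theorems, no
named facts) on the proof path of the named fact
`Literature.Analysis.FluidPDE.Elgindi.ElgindiGhoulMasmoudi2021_stabilityCore`
(`ElgindiStabilityDecomposition.lean`). T. M. Elgindi, T.-E. Ghoul, N. Masmoudi, Camb. J. Math. 9
(2021) = arXiv:1910.14071, §1.7 (p. 6): "We also define the `𝓦^{l,∞}` norm: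
`|f|_{𝓦^{l,∞}} = Σ_{0 ≤ k+j ≤ l} |(z+1)^k ∂_z^k (sin(2θ)/(γ−1+sin(2θ)) ∂_θ)^j f · sin(2θ)^{−α/5}|_{L^∞}`"
(with `γ = 1 + α/10`). The `L^∞` norm is taken over the open strip (essential supremum for the
Lebesgue measure), in `ℝ≥0∞`. (T. M. Elgindi, Ann. of Math. 194 (2021), §1.7.2 uses a variant
with `D_θ^j` and the weight `sin(2θ)^{−α/5}/(α + sin 2θ)`; it is not the one defined here.)
-/

noncomputable section

open MeasureTheory Set Function Real Filter Finset
open _root_.Topology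
open scoped ENNReal ContDiff

namespace Literature.Analysis.FluidPDE

namespace Elgindi

/-- The damped angular derivative `A_γ f = (sin 2θ/(γ − 1 + sin 2θ)) ∂_θ f` of the `𝓦^{l,∞}` norm. [cite: ElgindiGhoulMasmoudi2021, §1.7 (p. 6 of arXiv:1910.14071): the 𝓦^{l,∞} norm] -/
def angOpW (α : ℝ) (f : ℝ → ℝ → ℝ) : ℝ → ℝ → ℝ :=
  fun z θ => Real.sin (2 * θ) / (gammaExp α - 1 + Real.sin (2 * θ)) * dθ f z θ

/-- Unfolding `angOpW`. [folklore] -/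
theorem angOpW_apply (α : ℝ) (f : ℝ → ℝ → ℝ) (z θ : ℝ) :
    angOpW α f z θ = Real.sin (2 * θ) / (gammaExp α - 1 + Real.sin (2 * θ)) * dθ f z θ := rfl

/-- The term of orders `(k, j)` of the `𝓦^{l,∞}` norm:
`(z+1)^k ∂_z^k (A_γ)^j f · sin(2θ)^{−α/5}`. [cite: ElgindiGhoulMasmoudi2021, §1.7 (p. 6 of arXiv:1910.14071)] -/
def wkTerm (α : ℝ) (k j : ℕ) (f : ℝ → ℝ → ℝ) : ℝ → ℝ → ℝ :=
  fun z θ => (z + 1) ^ k * (dz^[k] ((angOpW α)^[j] f)) z θ * Real.sin (2 * θ) ^ (-(α / 5))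

/-- Unfolding `wkTerm`. [folklore] -/
theorem wkTerm_apply (α : ℝ) (k j : ℕ) (f : ℝ → ℝ → ℝ) (z θ : ℝ) :
    wkTerm α k j f z θ = (z + 1) ^ k * (dz^[k] ((angOpW α)^[j] f)) z θ * Real.sin (2 * θ) ^ (-(α / 5)) := rfl

/-- **The `𝓦^{l,∞}` norm** (Elgindi–Ghoul–Masmoudi 2021, §1.7), in `ℝ≥0∞`:
`|f|_{𝓦^{l,∞}} = Σ_{0 ≤ k + j ≤ l} ‖(z+1)^k ∂_z^k (A_γ)^j f · sin(2θ)^{−α/5}‖_{L^∞(strip)}`. [cite: ElgindiGhoulMasmoudi2021, §1.7 (p. 6 of arXiv:1910.14071): |f|_{𝓦^{l,∞}} = Σ_{0≤k+j≤l}|(z+1)^k∂_z^k((sin 2θ/(γ−1+sin 2θ))∂_θ)^j f sin(2θ)^{−α/5}|_{L^∞}] -/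
def eWkNorm (α : ℝ) (l : ℕ) (f : ℝ → ℝ → ℝ) : ℝ≥0∞ :=
  ∑ k ∈ range (l + 1), ∑ j ∈ range (l + 1),
    if k + j ≤ l then eLpNorm (fun p : ℝ × ℝ => wkTerm α k j f p.1 p.2) ∞ (volume.restrict strip) else 0

/-- `A_γ 0 = 0`. [folklore] -/
@[simp] theorem angOpW_zero (α : ℝ) : angOpW α 0 = 0 := by
  funext z θ; simp [angOpW, dθ]

/-- `(A_γ)^j 0 = 0`. [folklore] -/
@[simp] theorem iterate_angOpW_zero (α : ℝ) (j : ℕ) : (angOpW α)^[j] 0 = 0 := by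
  induction j with
  | zero => rfl
  | succ j ih => rw [Function.iterate_succ_apply, angOpW_zero, ih]

/-- `∂_z^k 0 = 0`. [folklore] -/
@[simp] theorem iterate_dz_zero (k : ℕ) : dz^[k] (0 : ℝ → ℝ → ℝ) = 0 := by
  induction k with
  | zero => rfl
  | succ k ih => rw [Function.iterate_succ_apply, dz_zero, ih]

/-- The terms of `0` vanish. [folklore] -/
@[simp] theorem wkTerm_zero (α : ℝ) (k j : ℕ) : wkTerm α k j 0 = 0 := by
  funext z θ; simp [wkTerm]

/-- `|0|_{𝓦^{l,∞}} = 0`. [folklore] -/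
@[simp] theorem eWkNorm_zero (α : ℝ) (l : ℕ) : eWkNorm α l 0 = 0 := by
  unfold eWkNorm
  refine sum_eq_zero fun k _ => sum_eq_zero fun j _ => ?_
  split_ifs
  · simp only [wkTerm_zero, Pi.zero_apply]
    exact eLpNorm_zero
  · rfl

/-- Each term is controlled by the norm: `‖wkTerm k j f‖_{L^∞(strip)} ≤ |f|_{𝓦^{l,∞}}` for `k + j ≤ l`. [folklore] -/
theorem eLpNorm_wkTerm_le (α : ℝ) {l k j : ℕ} (hkj : k + j ≤ l) (f : ℝ → ℝ → ℝ) :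
    eLpNorm (fun p : ℝ × ℝ => wkTerm α k j f p.1 p.2) ∞ (volume.restrict strip) ≤ eWkNorm α l f := by
  unfold eWkNorm
  have hk : k ∈ range (l + 1) := mem_range.2 (by omega)
  have hj : j ∈ range (l + 1) := mem_range.2 (by omega)
  refine le_trans ?_ (single_le_sum (f := fun k => ∑ j ∈ range (l + 1),
    if k + j ≤ l then eLpNorm (fun p : ℝ × ℝ => wkTerm α k j f p.1 p.2) ∞ (volume.restrict strip) else 0) (fun _ _ => bot_le) hk)
  refine le_trans ?_ (single_le_sum (f := fun j =>
    if k + j ≤ l then eLpNorm (fun p : ℝ × ℝ => wkTerm α k j f p.1 p.2) ∞ (volume.restrict strip) else 0) (fun _ _ => bot_le) hj)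
  simp only [if_pos hkj, le_refl]

/-- **The sup bound encoded by the norm**: a.e. on the strip, `|(z+1)^k ∂_z^k (A_γ)^j f| · sin(2θ)^{−α/5} ≤ |f|_{𝓦^{l,∞}}`
(`k + j ≤ l`). [cite: ElgindiGhoulMasmoudi2021, §1.7 (p. 6 of arXiv:1910.14071)] -/
theorem ae_abs_wkTerm_le (α : ℝ) {l k j : ℕ} (hkj : k + j ≤ l) (f : ℝ → ℝ → ℝ) :
    ∀ᵐ p ∂(volume.restrict strip), ENNReal.ofReal |wkTerm α k j f p.1 p.2| ≤ eWkNorm α l f := by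
  have h := ae_le_eLpNormEssSup (μ := volume.restrict strip) (f := fun p : ℝ × ℝ => wkTerm α k j f p.1 p.2)
  filter_upwards [h] with p hp
  rw [← Real.enorm_eq_ofReal_abs]
  refine hp.trans ?_
  rw [← eLpNorm_exponent_top]
  exact eLpNorm_wkTerm_le α hkj f

end Elgindi

end Literature.Analysis.FluidPDE
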